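import Summits.CriticalPhenomena.SAWScalingLimit.Theorems.SAWDefectDecoherenceBoundaryClosureRZigzagDiscretisationPins
import HarnessLib

/-!
# Crux `BoundaryClosureR` (stmt-CriticalPhenomena-14004), line `polygon-parity-squeeze`,
# stub `stub_innerPolygonsOfZigzag` (7b): faces passing the tests belong to `Λ δ`

Landing target:
`Summits/CriticalPhenomena/SAWScalingLimit/Theorems/SAWDefectDecoherenceBoundaryClosureRZigzagDiscretisationMember.lean`
(`--supports stmt-CriticalPhenomena-14004`; building block of the registered stub
`stub_innerPolygonsOfZigzag`, the lattice half of the inner-polygon construction (IP)).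

EXACTNESS of the trimmed discretisation `Λ^P_δ = {v ∈ Λ δ | zdPass … v}` requires that, eventually,
EVERY face passing the local tests already lies in `Λ δ` (then `Λ^P_δ` is literally the set of faces
passing the tests).  Away from the two pinned discs this is the exhaustion of compacts of `Ω` by
`Λ δ` (the closure of `P` minus the pinned discs is a compact subset of `Ω`); inside a pinned disc
`Λ δ` is the pinned half-lattice `{m δ ≤ v.1 1}` and one argues (`mem_of_zdPass_near_pin`):
a passing face far from the frontier carries a ball of radius `r/8` inside `P`, hence lies `r/8`
above the pinned line (a fixed compact of `Ω`); a face passing a PIN test has `m δ ≤ v.1 1` by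
definition; a face passing a GENERIC test (threshold `zdThr + u`, `u` the float) carries a ball of
radius `(√3/2)·u·δ` inside `P`, hence lies `(√3/2)·u·δ` above the pinned line, which is
`≥ u - 1 ≥ |m δ - zdThr 0 (pt 1) δ|` rows above the least row: `m δ ≤ v.1 1` again.

* `mem_of_zdPass_near_pin` — the one-mesh statement at an abstract pin;
* `eventually_mem_of_zdPass` — **K1**: eventually every face passing `zdPass` lies in `Λ δ`.

Sources: H. Duminil-Copin, S. Smirnov, Ann. of Math. 175 (2012) §2–§3.  No proposition is defined and
no named fact is introduced.
-/

noncomputable section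

open scoped ComplexConjugate Topology
open Set Metric Filter
open Literature.Probability.LatticeModels Literature.Probability.RandomPlanarGeometry
  Literature.Probability.RandomPlanarGeometry.SAW
open Summit.CriticalPhenomena.SAWScalingLimit.Theorems.PolygonParitySqueeze.InnerZigzag
  (level_split level_add_smul halfPlane_eq_of_level_eq_zero)

namespace Summit.CriticalPhenomena.SAWScalingLimit.Theorems.PolygonParitySqueeze.ZigzagDiscretisation

/-! ### 1. One mesh, one pin -/

/-- **Faces passing the tests near a pin are in the pinned half-lattice** (one mesh).  Pin `(x, R, mr)`:
`Ω ∩ ball x R` is the open upper half-ball, `Λ'` is pinned there (`v ∈ Λ' ↔ mr ≤ v.1 1`), the faces of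
the compact `{im ≥ im x + r/8} ∩ closedBall x (15R/16)` are in `Λ'`; thresholds `T` whose pin tests
at `x` equal `mr` and whose other tests, at frontier points within `15R/16 + 2r` of `x`, are passed only
at signed level `> l`, where `0 < l ≤ r/16` and a face at height `≥ l` above the line has
`mr ≤ v.1 1`.  Then every face passing `zdPass` with scaled centre in `ball x (15R/16)` is in `Λ'`.
[folklore] -/
theorem mem_of_zdPass_near_pin {D : DobrushinDomain} {S : Set ℂ} {Cor : Finset ℂ} {κ : ℂ → Fin 6 × Fin 6 × Bool}
    {r R l δ : ℝ} {x : ℂ} {mr : ℤ} {Λ' : Finset HexVertex} {T : Fin 6 → ℂ → ℤ}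
    (hSo : IsOpen S) (hSc : Sᶜ.Nonempty) (hSD : S ⊆ D.carrier) (hr : 0 < r) (hrR : r ≤ R / 16)
    (hl : 0 < l) (hlr : l ≤ r / 16)
    (hflat : ∀ z ∈ frontier S, (∀ c ∈ Cor, r ≤ dist z c) → ∃ k : Fin 6, S ∩ ball z (r / 2) = halfPlane k z ∩ ball z (r / 2))
    (Hκ : ∀ c ∈ Cor, ((κ c).2.2 = true ∧ S ∩ ball c (2 * r) = halfPlane (κ c).1 c ∩ halfPlane (κ c).2.1 c ∩ ball c (2 * r)) ∨
      ((κ c).2.2 = false ∧ S ∩ ball c (2 * r) = (halfPlane (κ c).1 c ∪ halfPlane (κ c).2.1 c) ∩ ball c (2 * r)))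
    (hCor : ∀ c ∈ Cor, c ∈ frontier S)
    (hDx : D.carrier ∩ ball x R = {z : ℂ | x.im < z.im} ∩ ball x R)
    (hpin : ∀ v : HexVertex, (δ : ℂ) * hexCenter v ∈ ball x R → (v ∈ Λ' ↔ mr ≤ v.1 1))
    (hK : ∀ v : HexVertex, (δ : ℂ) * hexCenter v ∈ {w : ℂ | x.im + r / 8 ≤ w.im} ∩ closedBall x (15 * R / 16) → v ∈ Λ')
    (hTzone : ∀ z : ℂ, z.im = x.im → dist z x < R → T 0 z = mr)
    (hTgen : ∀ (j : Fin 6) (z : ℂ) (v : HexVertex), z ∈ frontier S → dist z x < 15 * R / 16 + 2 * r →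
      ¬ (j = 0 ∧ z.im = x.im ∧ dist z x < R) → T j z ≤ zigzagForm j v →
      l < (((δ : ℂ) * hexCenter v - z) * conj (innerNormal j)).re)
    (hlrow : ∀ v : HexVertex, x.im + l ≤ ((δ : ℂ) * hexCenter v).im → mr ≤ v.1 1)
    {v : HexVertex} (hv : zdPass S Cor κ r T δ v = true) (hvx : (δ : ℂ) * hexCenter v ∈ ball x (15 * R / 16)) :
    v ∈ Λ' := by
  rw [zdPass_iff] at hv
  obtain ⟨hpS, hside, hcorner⟩ := hv
  set p : ℂ := (δ : ℂ) * hexCenter v with hp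
  have hpx : dist p x < 15 * R / 16 := mem_ball.1 hvx
  have hR : 0 < R := by linarith
  have hpR : p ∈ ball x R := mem_ball.2 (by linarith)
  -- a ball about `p` inside `S` and inside `ball x R` lies above the line
  have above : ∀ s : ℝ, 0 < s → s ≤ r / 8 → ball p s ⊆ S → x.im + s ≤ p.im := by
    intro s hs hsr hball
    apply im_ge_of_ball_subset_upper hs
    intro w hw
    have hwR : w ∈ ball x R := by
      rw [mem_ball] at hw ⊢
      calc dist w x ≤ dist w p + dist p x := dist_triangle _ _ _
        _ < s + 15 * R / 16 := by linarith
        _ ≤ R := by linarith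
    have : w ∈ D.carrier ∩ ball x R := ⟨hSD (hball hw), hwR⟩
    rw [hDx] at this
    exact this.1
  -- conclusion via the pin once `p` is `l` above the line
  have concl : (∃ s : ℝ, l ≤ s ∧ s ≤ r / 8 ∧ ball p s ⊆ S) → v ∈ Λ' := by
    rintro ⟨s, hls, hsr, hball⟩
    have := above s (by linarith) hsr hball
    exact (hpin v hpR).2 (hlrow v (by rw [← hp]; linarith))
  -- the nearest frontier point
  obtain ⟨w, hwF, hwd⟩ := exists_frontier_of_mem hSo hSc hpS
  by_cases hw : r / 8 ≤ dist p w
  · -- far from the frontier: `ball p (r/8) ⊆ S`, `p` is `r/8` above the line, in the compact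
    have hball : ball p (r / 8) ⊆ S := ball_subset_of_le_infDist (by rw [← hwd]; exact hw)
    have := above (r / 8) (by positivity) le_rfl hball
    exact hK v ⟨by rw [← hp]; exact this, mem_closedBall.2 hpx.le⟩
  push Not at hw
  -- a passing test at a frontier point `z` near `x`: pin test or deep
  have test : ∀ (j : Fin 6) (z : ℂ), z ∈ frontier S → dist z x < 15 * R / 16 + 2 * r → T j z ≤ zigzagForm j v →
      mr ≤ v.1 1 ∨ l < ((p - z) * conj (innerNormal j)).re := by
    intro j z hz hzx hT
    by_cases hzone : j = 0 ∧ z.im = x.im ∧ dist z x < R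
    · obtain ⟨rfl, hzim, hzd⟩ := hzone
      left
      rw [hTzone z hzim hzd] at hT
      simpa [zigzagForm] using hT
    · right; exact hTgen j z v hz hzx hzone hT
  by_cases hfar : ∀ c ∈ Cor, r ≤ dist w c
  · -- flat chart at `w`
    obtain ⟨k, hk⟩ := hflat w hwF hfar
    have hT := hside w hwF hfar hw k hk
    have hwx : dist w x < 15 * R / 16 + 2 * r := by
      calc dist w x ≤ dist w p + dist p x := dist_triangle _ _ _
        _ < r / 8 + 15 * R / 16 := by rw [dist_comm]; linarith
        _ < 15 * R / 16 + 2 * r := by linarith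
    rcases test k w hwF hwx hT with h | h
    · exact (hpin v hpR).2 h
    · refine concl ⟨l, le_rfl, by linarith, fun y hy => ?_⟩
      have hy1 : y ∈ halfPlane k w := ball_subset_halfPlane_of_level k w p l h.le hy
      have hy2 : y ∈ ball w (r / 2) := by
        rw [mem_ball] at hy ⊢
        calc dist y w ≤ dist y p + dist p w := dist_triangle _ _ _
          _ < l + r / 8 := by linarith
          _ ≤ r / 2 := by linarith
      have : y ∈ S ∩ ball w (r / 2) := by rw [hk]; exact ⟨hy1, hy2⟩
      exact this.1
  · -- corner chart at the corner `c` within `r` of `w`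
    push Not at hfar
    obtain ⟨c, hc, hwc⟩ := hfar
    have hpc : dist p c < 9 * r / 8 := by
      calc dist p c ≤ dist p w + dist w c := dist_triangle _ _ _
        _ < r / 8 + r := by linarith
        _ = 9 * r / 8 := by ring
    have hcx : dist c x < 15 * R / 16 + 2 * r := by
      calc dist c x ≤ dist c p + dist p x := dist_triangle _ _ _
        _ < 9 * r / 8 + 15 * R / 16 := by rw [dist_comm]; linarith
        _ < 15 * R / 16 + 2 * r := by linarith
    obtain ⟨hconv, hrefl⟩ := hcorner c hc (by linarith)
    have hcF := hCor c hc
    -- a ball about `p` at positive level of a form of the chart, inside the chart ball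
    have ballc : ball p l ⊆ ball c (2 * r) := by
      intro y hy
      rw [mem_ball] at hy ⊢
      calc dist y c ≤ dist y p + dist p c := dist_triangle _ _ _
        _ < l + 9 * r / 8 := by linarith
        _ ≤ 2 * r := by linarith
    rcases Hκ c hc with ⟨hb, hch⟩ | ⟨hb, hch⟩
    · obtain ⟨h1, h2⟩ := hconv hb
      rcases test _ c hcF hcx h1 with h | hl1
      · exact (hpin v hpR).2 h
      rcases test _ c hcF hcx h2 with h | hl2
      · exact (hpin v hpR).2 h
      refine concl ⟨l, le_rfl, by linarith, fun y hy => ?_⟩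
      have : y ∈ S ∩ ball c (2 * r) := by
        rw [hch]
        exact ⟨⟨ball_subset_halfPlane_of_level _ c p l hl1.le hy, ball_subset_halfPlane_of_level _ c p l hl2.le hy⟩,
          ballc hy⟩
      exact this.1
    · rcases hrefl hb with h1 | h1
      · rcases test _ c hcF hcx h1 with h | hl1
        · exact (hpin v hpR).2 h
        refine concl ⟨l, le_rfl, by linarith, fun y hy => ?_⟩
        have : y ∈ S ∩ ball c (2 * r) := by
          rw [hch]; exact ⟨Or.inl (ball_subset_halfPlane_of_level _ c p l hl1.le hy), ballc hy⟩
        exact this.1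
      · rcases test _ c hcF hcx h1 with h | hl1
        · exact (hpin v hpR).2 h
        refine concl ⟨l, le_rfl, by linarith, fun y hy => ?_⟩
        have : y ∈ S ∩ ball c (2 * r) := by
          rw [hch]; exact ⟨Or.inr (ball_subset_halfPlane_of_level _ c p l hl1.le hy), ballc hy⟩
        exact this.1

/-! ### 2. K1: eventually every passing face is in `Λ δ` -/

/-- Height-`l` faces are at least `u - 1` rows above the least row, hence above the pin once
`|pin - least row| ≤ u - 1`. [folklore] -/
theorem pin_le_row_of_height {x : ℂ} {δ : ℝ} (hδ : 0 < δ) {mr U : ℤ} (hU : |mr - zdThr 0 x δ| + 1 ≤ U)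
    (v : HexVertex) (h : x.im + δ * (Real.sqrt 3 / 2 * U) ≤ ((δ : ℂ) * hexCenter v).im) : mr ≤ v.1 1 := by
  have h3p : 0 < Real.sqrt 3 := Real.sqrt_pos.2 (by norm_num)
  have hlev : δ * (Real.sqrt 3 / 6 + Real.sqrt 3 / 2 * ((U - 1 : ℤ) : ℝ)) <
      (((δ : ℂ) * hexCenter v - x) * conj (innerNormal 0)).re := by
    rw [level_zero_eq_im, Complex.sub_im]
    push_cast
    nlinarith
  have h1 := zdThr_add_le_of_lt_level 0 x hδ (U - 1) v hlev
  have h2 := le_abs_self (mr - zdThr 0 x δ)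
  have : zigzagForm 0 v = v.1 1 := rfl
  omega

/-- **K1: eventually, every face passing the tests lies in `Λ δ`.**  Inputs: the admissible pinned
family `(Λ, m, b; a, r₀, m₀)` of `Ω`, the carrier `S ⊆ Ω` of the inner polygon with its charts, the two
half-discs of `Ω` at the pins (radii `ρ`, `r₁ ≤ r₀`, `ρ + r₁ ≤ |pt 0 - pt 1|`), and the frontier of `S`
off the two `15/16`-discs inside `Ω`. [folklore] -/
theorem eventually_mem_of_zdPass {D : DobrushinDomain} {S : Set ℂ} {Cor : Finset ℂ} {κ : ℂ → Fin 6 × Fin 6 × Bool}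
    {r ρ r₁ r₀ : ℝ} {Λ : ℝ → Finset HexVertex} {m m₀ : ℝ → ℤ} {a b : ℝ → Sym2 HexVertex}
    (hA : AdmissibleFamily D ρ Λ m b) (hP : PinnedFlatRoot D Λ b (D.pt 0) a r₀ m₀)
    (hSo : IsOpen S) (hSD : S ⊆ D.carrier) (hr : 0 < r) (hrρ : r ≤ ρ / 16) (hrr₁ : r ≤ r₁ / 16) (hr₁r₀ : r₁ ≤ r₀)
    (hD0 : D.carrier ∩ ball (D.pt 0) r₁ = {z : ℂ | (D.pt 0).im < z.im} ∩ ball (D.pt 0) r₁)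
    (hF : ∀ w ∈ frontier S, w ∉ ball (D.pt 1) (15 * ρ / 16) → w ∉ ball (D.pt 0) (15 * r₁ / 16) → w ∈ D.carrier)
    (hdist : ρ + r₁ ≤ dist (D.pt 0) (D.pt 1))
    (hflat : ∀ z ∈ frontier S, (∀ c ∈ Cor, r ≤ dist z c) → ∃ k : Fin 6, S ∩ ball z (r / 2) = halfPlane k z ∩ ball z (r / 2))
    (Hκ : ∀ c ∈ Cor, ((κ c).2.2 = true ∧ S ∩ ball c (2 * r) = halfPlane (κ c).1 c ∩ halfPlane (κ c).2.1 c ∩ ball c (2 * r)) ∨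
      ((κ c).2.2 = false ∧ S ∩ ball c (2 * r) = (halfPlane (κ c).1 c ∪ halfPlane (κ c).2.1 c) ∩ ball c (2 * r)))
    (hCor : ∀ c ∈ Cor, c ∈ frontier S) :
    ∀ᶠ δ : ℝ in 𝓝[>] 0, ∀ v : HexVertex,
      zdPass S Cor κ r (zdT (D.pt 1) (D.pt 0) ρ r₁ (m δ) (m₀ δ) δ) δ v = true → v ∈ Λ δ := by
  have hfloat := eventually_delta_mul_float_le hA hP (show (0 : ℝ) < r / 16 by positivity)
  obtain ⟨hρ, hD1, hev, hexh, -⟩ := hA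
  obtain ⟨hr₀, -, hev0, -⟩ := hP
  have hr₁ : 0 < r₁ := by linarith
  set x₁ := D.pt 1 with hx₁
  set x₀ := D.pt 0 with hx₀
  -- `Sᶜ ≠ ∅`, `closure S` compact
  have hSc : Sᶜ.Nonempty := by
    by_contra h
    rw [not_nonempty_iff_eq_empty, compl_empty_iff] at h
    exact D.toJordanDomain.carrier_ne_univ (univ_subset_iff.1 (h ▸ hSD))
  have hcl : IsCompact (closure S) := (D.isBounded.subset hSD).isCompact_closure
  -- the three compacts of `Ω`
  set K₀ : Set ℂ := closure S \ (ball x₁ (15 * ρ / 16) ∪ ball x₀ (15 * r₁ / 16)) with hK₀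
  have hK₀c : IsCompact K₀ := hcl.diff (isOpen_ball.union isOpen_ball)
  have hK₀D : K₀ ⊆ D.carrier := by
    rintro w ⟨hw, hwB⟩
    rw [closure_eq_self_union_frontier] at hw
    rcases hw with hw | hw
    · exact hSD hw
    · rw [mem_union, not_or] at hwB
      exact hF w hw hwB.1 hwB.2
  have upperD : ∀ (x : ℂ) (R : ℝ), D.carrier ∩ ball x R = {z : ℂ | x.im < z.im} ∩ ball x R → 0 < R →
      {w : ℂ | x.im + r / 8 ≤ w.im} ∩ closedBall x (15 * R / 16) ⊆ D.carrier := by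
    intro x R hDx hR w ⟨hw1, hw2⟩
    have : w ∈ {z : ℂ | x.im < z.im} ∩ ball x R := by
      refine ⟨?_, ?_⟩
      · rw [mem_setOf_eq] at hw1 ⊢; linarith
      · rw [mem_closedBall] at hw2; rw [mem_ball]; linarith
    rw [← hDx] at this
    exact this.1
  have hK₁c : IsCompact ({w : ℂ | x₁.im + r / 8 ≤ w.im} ∩ closedBall x₁ (15 * ρ / 16)) :=
    (isCompact_closedBall _ _).inter_left (isClosed_le continuous_const Complex.continuous_im)
  have hK₀'c : IsCompact ({w : ℂ | x₀.im + r / 8 ≤ w.im} ∩ closedBall x₀ (15 * r₁ / 16)) :=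
    (isCompact_closedBall _ _).inter_left (isClosed_le continuous_const Complex.continuous_im)
  have hδ1 : ∀ᶠ δ : ℝ in 𝓝[>] 0, δ ∈ Ioo (0 : ℝ) 1 := Ioo_mem_nhdsGT one_pos
  filter_upwards [hexh K₀ hK₀c hK₀D, hexh _ hK₁c (upperD x₁ ρ hD1 hρ), hexh _ hK₀'c (upperD x₀ r₁ hD0 hr₁), hev, hev0,
    hfloat, hδ1] with δ hK₀δ hK₁δ hK₀'δ hevδ hev0δ hflδ hδδ v hv
  obtain ⟨-, -, -, hcar, hpin1⟩ := hevδ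
  obtain ⟨-, -, hpin0⟩ := hev0δ
  have hδ : 0 < δ := hδδ.1
  set U : ℤ := |m δ - zdThr 0 x₁ δ| + |m₀ δ - zdThr 0 x₀ δ| + 2 with hU
  have hU2 : (2 : ℝ) ≤ U := by
    have h1 := abs_nonneg (m δ - zdThr 0 x₁ δ)
    have h2 := abs_nonneg (m₀ δ - zdThr 0 x₀ δ)
    have : (2 : ℤ) ≤ U := by rw [hU]; linarith
    exact_mod_cast this
  set l : ℝ := δ * (Real.sqrt 3 / 2 * U) with hl
  have h3p : 0 < Real.sqrt 3 := Real.sqrt_pos.2 (by norm_num)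
  have h32 : Real.sqrt 3 < 2 := by
    rw [show (2 : ℝ) = Real.sqrt 4 by rw [show (4 : ℝ) = 2 ^ 2 by norm_num, Real.sqrt_sq (by norm_num)]]
    exact Real.sqrt_lt_sqrt (by norm_num) (by norm_num)
  have hl0 : 0 < l := by rw [hl]; positivity
  have hlr : l ≤ r / 16 := by
    rw [hl]
    have : δ * (U : ℝ) ≤ r / 16 := hflδ
    nlinarith
  have hpS : (δ : ℂ) * hexCenter v ∈ S := ((zdPass_iff _ _ _ _ _ _ _).1 hv).1
  set p : ℂ := (δ : ℂ) * hexCenter v with hp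
  -- the two gaps
  have gap1 : ∀ z ∈ frontier S, z.im = x₁.im → dist z x₁ < ρ → dist z x₁ < 15 * ρ / 16 := fun z hz hzim hzd =>
    gap_pin hD1 hF (by rw [dist_comm]; exact hdist) hr₁.le hz hzim hzd
  have gap0 : ∀ z ∈ frontier S, z.im = x₀.im → dist z x₀ < r₁ → dist z x₀ < 15 * r₁ / 16 := fun z hz hzim hzd =>
    gap_pin hD0 (fun w hw h0 h1 => hF w hw h1 h0) (by rw [add_comm]; exact hdist) hρ.le hz hzim hzd
  by_cases hp1 : p ∈ ball x₁ (15 * ρ / 16)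
  · refine mem_of_zdPass_near_pin (Λ' := Λ δ) hSo hSc hSD hr hrρ hl0 hlr hflat Hκ hCor hD1 hpin1 hK₁δ
      (fun z hz hd => zdT_gate x₁ x₀ ρ r₁ (m δ) (m₀ δ) δ hz hd) (fun j z w hz hzx hnz hT => ?_) (fun w hw => ?_) hv hp1
    · refine level_gt_of_zdT_le_generic x₁ x₀ ρ r₁ (m δ) (m₀ δ) hδ w hnz (fun ⟨_, hzim, hzd⟩ => ?_) hT
      have h1 := gap0 z hz hzim hzd
      have h2 := dist_triangle x₀ z x₁
      rw [dist_comm x₀ z] at h2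
      linarith
    · refine pin_le_row_of_height hδ (U := U) ?_ w (by rw [← hl]; exact hw)
      rw [hU]; have := abs_nonneg (m₀ δ - zdThr 0 x₀ δ); linarith
  by_cases hp0 : p ∈ ball x₀ (15 * r₁ / 16)
  · refine mem_of_zdPass_near_pin (Λ' := Λ δ) hSo hSc hSD hr hrr₁ hl0 hlr hflat Hκ hCor hD0
      (fun w hw => hpin0 w (ball_subset_ball hr₁r₀ hw)) hK₀'δ
      (fun z hz hd => zdT_root x₁ x₀ ρ r₁ (m δ) (m₀ δ) δ hz hd hdist) (fun j z w hz hzx hnz hT => ?_) (fun w hw => ?_) hv hp0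
    · refine level_gt_of_zdT_le_generic x₁ x₀ ρ r₁ (m δ) (m₀ δ) hδ w (fun ⟨_, hzim, hzd⟩ => ?_) hnz hT
      have h1 := gap1 z hz hzim hzd
      have h2 := dist_triangle x₀ z x₁
      rw [dist_comm x₀ z] at h2
      linarith
    · refine pin_le_row_of_height hδ (U := U) ?_ w (by rw [← hl]; exact hw)
      rw [hU]; have := abs_nonneg (m δ - zdThr 0 x₁ δ); linarith
  · exact hK₀δ v ⟨subset_closure hpS, by rw [mem_union, not_or]; exact ⟨hp1, hp0⟩⟩

/-- **Height-`(√3/2)uδ` faces are above the pin** (registered form, sub-goal of `stub_innerPolygonsOfZigzag`). [folklore] -/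
theorem zd_pin_le_row_of_height : ∀ (x : ℂ) (δ : ℝ), 0 < δ → ∀ (mr U : ℤ), |mr - zdThr 0 x δ| + 1 ≤ U → ∀ (v : HexVertex), x.im + δ * (Real.sqrt 3 / 2 * U) ≤ ((δ : ℂ) * hexCenter v).im → mr ≤ v.1 1 :=
  fun x _ hδ _ _ hU v h => pin_le_row_of_height (x := x) hδ hU v h

end Summit.CriticalPhenomena.SAWScalingLimit.Theorems.PolygonParitySqueeze.ZigzagDiscretisation

end
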